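import Summits.KontsevichZagierPeriods.Zeta5Search.TwoTaleOmega.StepB
import Summits.KontsevichZagierPeriods.Zeta5Search.TwoTaleOmega.StepE
import Summits.KontsevichZagierPeriods.Zeta5Search.TwoTaleOmega.StepF
import Summits.KontsevichZagierPeriods.Zeta5Search.TwoTaleOmega.StepG
import Summits.KontsevichZagierPeriods.Zeta5Search.TwoTaleOmega.StepBG

/-!
# (bmiss)@Ω — the directions `b, e, f, g, bg` of cert-2's step hypotheses `hL/hR` (cell `pub-zeta5`, cert-1 gen 4)

HONEST FRAMING: systematic search; recurrence certificates; no irrationality claim unless certified. Pure bookkeeping; no named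
fact, no `sorry`.

cert-2's `Certificates/TwoTaleOmegaAefTable.eq_on_Omega_all` runs fam-tele's Ω-induction for functions `I_L, I_R` on `Fin 5 → ℤ`
with the kernel coefficient tables; its hypotheses `hL/hR` ask, for EVERY direction `δ` and every base point `p₀ ∈ StepBase Legit δ`,
`Σ_{k<4} coef(δ,p₀,k)·I(p₀ + kδ) = 0`. For the kernel hinge forms `I := U1 ∘ ofVec` and `I := U0 ∘ ofVec` (`OmegaForms`,
`OmegaBridge`) this file discharges the five directions `δ ∈ {dirB, dirE, dirF, dirG, dirBG}` at once from `StepB.rec_b`,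
`StepE.rec_e`, `StepF.rec_f`, `StepG.rec_g`, `StepBG.rec_bg` (first tales of `g`, `bg`: fam-tele's `StepGL`, `StepBGL`)
(`hstep5_U1`, `hstep5_U0`; any legitimacy predicate, any `aef` table). Only the directions `a` and `aef` of `dirs` remain.
-/

noncomputable section

open Finset
open Summit.KontsevichZagierPeriods.Zeta5Search.Certificates.TwoTaleTelescope

namespace Summit.KontsevichZagierPeriods.Zeta5Search.TwoTaleOmega

/-- The four points of a certified step, moved to fam-tele's `Pt` and its Ω. -/
theorem omega_four_of_stepBase {Legit : Certificates.TwoTaleTelescope.Pt → Certificates.TwoTaleTelescope.Pt → Prop}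
    {δ p₀ : Certificates.TwoTaleTelescope.Pt} (h : p₀ ∈ StepBase Legit δ) :
    (ofVec p₀).Omega ∧ (ofVec (p₀ + (1 : ℤ) • δ)).Omega ∧ (ofVec (p₀ + (2 : ℤ) • δ)).Omega ∧ (ofVec (p₀ + (3 : ℤ) • δ)).Omega := by
  have hΩ := h.2.1
  refine ⟨?_, ?_, ?_, ?_⟩
  · have := Omega_ofVec (hΩ 0 (by norm_num)); simpa using this
  · exact Omega_ofVec (by simpa using hΩ 1 (by norm_num))
  · exact Omega_ofVec (by simpa using hΩ 2 (by norm_num))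
  · exact Omega_ofVec (by simpa using hΩ 3 (by norm_num))

/-- **Plug-in form for cert-2's Ω-induction, `U1`, directions `b, e, f, g, bg`.** -/
theorem hstep5_U1 (cAEF : Certificates.TwoTaleTelescope.Pt → ℕ → ℤ) (Legit : Certificates.TwoTaleTelescope.Pt →
    Certificates.TwoTaleTelescope.Pt → Prop) {δ : Certificates.TwoTaleTelescope.Pt}
    (hδ : δ = dirB ∨ δ = dirE ∨ δ = dirF ∨ δ = dirG ∨ δ = dirBG)
    (p₀ : Certificates.TwoTaleTelescope.Pt) (h : p₀ ∈ StepBase Legit δ) :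
    ∑ k ∈ range 4, (coef cAEF δ p₀ k : ℚ) * (ofVec (p₀ + (k : ℤ) • δ)).U1 = 0 := by
  obtain ⟨h0, h1, h2, h3⟩ := omega_four_of_stepBase h
  rw [sum_range_succ, sum_range_succ, sum_range_succ, sum_range_one]
  push_cast
  rw [zero_smul, add_zero]
  rcases hδ with rfl | rfl | rfl | rfl | rfl
  · rw [ofVec_add_dirB] at h1 h2 h3 ⊢; rw [ofVec_add_dirB, ofVec_add_dirB]
    simp only [coef_B, tabAt_cast, tabB]
    simpa [Pt.coefB] using (Pt.rec_b h0 h1 h2 h3).1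
  · rw [ofVec_add_dirE] at h1 h2 h3 ⊢; rw [ofVec_add_dirE, ofVec_add_dirE]
    simp only [coef_E, tabAt_cast, tabE]
    simpa [Pt.coefE] using (Pt.rec_e h0 h1 h2 h3).1
  · rw [ofVec_add_dirF] at h1 h2 h3 ⊢; rw [ofVec_add_dirF, ofVec_add_dirF]
    simp only [coef_F, tabAt_cast, tabF]
    simpa [Pt.coefF] using (Pt.rec_f h0 h1 h2 h3).1
  · rw [ofVec_add_dirG] at h1 h2 h3 ⊢; rw [ofVec_add_dirG, ofVec_add_dirG]
    simp only [coef_G, tabAt_cast, tabG]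
    simpa [Pt.coefG] using (Pt.rec_g h0 h1 h2 h3).1
  · rw [ofVec_add_dirBG] at h1 h2 h3 ⊢; rw [ofVec_add_dirBG, ofVec_add_dirBG]
    simp only [coef_BG, tabAt_cast, tabBG]
    simpa [Pt.coefBG] using (Pt.rec_bg h0 h1 h2 h3).1

/-- **Plug-in form for cert-2's Ω-induction, `U0`, directions `b, e, f, g, bg`.** -/
theorem hstep5_U0 (cAEF : Certificates.TwoTaleTelescope.Pt → ℕ → ℤ) (Legit : Certificates.TwoTaleTelescope.Pt →
    Certificates.TwoTaleTelescope.Pt → Prop) {δ : Certificates.TwoTaleTelescope.Pt}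
    (hδ : δ = dirB ∨ δ = dirE ∨ δ = dirF ∨ δ = dirG ∨ δ = dirBG)
    (p₀ : Certificates.TwoTaleTelescope.Pt) (h : p₀ ∈ StepBase Legit δ) :
    ∑ k ∈ range 4, (coef cAEF δ p₀ k : ℚ) * (ofVec (p₀ + (k : ℤ) • δ)).U0 = 0 := by
  obtain ⟨h0, h1, h2, h3⟩ := omega_four_of_stepBase h
  rw [sum_range_succ, sum_range_succ, sum_range_succ, sum_range_one]
  push_cast
  rw [zero_smul, add_zero]
  rcases hδ with rfl | rfl | rfl | rfl | rfl
  · rw [ofVec_add_dirB] at h1 h2 h3 ⊢; rw [ofVec_add_dirB, ofVec_add_dirB]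
    simp only [coef_B, tabAt_cast, tabB]
    simpa [Pt.coefB] using (Pt.rec_b h0 h1 h2 h3).2
  · rw [ofVec_add_dirE] at h1 h2 h3 ⊢; rw [ofVec_add_dirE, ofVec_add_dirE]
    simp only [coef_E, tabAt_cast, tabE]
    simpa [Pt.coefE] using (Pt.rec_e h0 h1 h2 h3).2
  · rw [ofVec_add_dirF] at h1 h2 h3 ⊢; rw [ofVec_add_dirF, ofVec_add_dirF]
    simp only [coef_F, tabAt_cast, tabF]
    simpa [Pt.coefF] using (Pt.rec_f h0 h1 h2 h3).2
  · rw [ofVec_add_dirG] at h1 h2 h3 ⊢; rw [ofVec_add_dirG, ofVec_add_dirG]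
    simp only [coef_G, tabAt_cast, tabG]
    simpa [Pt.coefG] using (Pt.rec_g h0 h1 h2 h3).2
  · rw [ofVec_add_dirBG] at h1 h2 h3 ⊢; rw [ofVec_add_dirBG, ofVec_add_dirBG]
    simp only [coef_BG, tabAt_cast, tabBG]
    simpa [Pt.coefBG] using (Pt.rec_bg h0 h1 h2 h3).2

end Summit.KontsevichZagierPeriods.Zeta5Search.TwoTaleOmega

end
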